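import Literature.Computability.Complexity.NegacyclicFFTBatch
import HarnessLib

/-!
# The breadth-first form of the recursive negacyclic multiplier

Literature / complexity toolkit, continuing `NegacyclicFFTBatch.lean`.  The stack machine runs
`negMulRec` (`NegacyclicFFT.lean`) on a BATCH: all descents (digits + forward transforms, flat
over the instances), then the schoolbook products of the leaves, then all ascents (inverse
transforms + overlap-add, instance by instance).  This file is the list-level statement that the
two agree:

* `chunks t` (successive chunks; `chunks_flatten`), `zipWith_flatMap` (zips of flat batches with
  uniform instance length are flattened instance-wise zips);
* `descOne N k`, `ascOne N k` (one descent / ascent at exponent `k`: `m = 2^{⌈k/2⌉}`,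
  `t = 2^{⌊k/2⌋}`, root twiddle `2m`), and **`bfRec N k Fb Gb`** — the breadth-first recursion;
  **`bfRec_eq`**: `bfRec N k Fb Gb = zipWith (negMulRec N k) Fb Gb` for batches of equal size;
* `twAt m F B j` (the twiddle list of level `j` of `B` trees) and `invBatch_replicate` (the
  inverted batch over `B` equal roots is the chunkwise `invN`), for the ascent.

## References

* J. von zur Gathen, J. Gerhard, *Modern Computer Algebra*, 3rd ed., CUP 2013, §8.3 Alg. 8.20.
  (Folklore material, fully proved here.)
-/


namespace Literature.Computability.Complexity

namespace NegFFT

open _root_.Computability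

/-- Successive chunks of length `t` (the last one possibly shorter; none if the list is empty). [folklore] -/
def chunks {α : Type*} (t : ℕ) : List α → List (List α)
  | [] => []
  | a :: l => if t = 0 then [a :: l] else (a :: l).take t :: chunks t ((a :: l).drop t)
  termination_by l => l.length
  decreasing_by simp only [List.length_drop, List.length_cons]; omega

/-- Chunking a concatenation of lists of length `t ≥ 1` recovers them. [folklore] -/
theorem chunks_flatten {α : Type*} {t : ℕ} (ht : 0 < t) : ∀ (Ls : List (List α)), (∀ L ∈ Ls, L.length = t) → chunks t Ls.flatten = Ls
  | [], _ => by simp [chunks]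
  | L :: Ls, hLs => by
    have hL : L.length = t := hLs L (by simp)
    obtain ⟨a, L', rfl⟩ : ∃ a L', L = a :: L' := by
      cases L with
      | nil => simp at hL; omega
      | cons a L' => exact ⟨a, L', rfl⟩
    rw [List.flatten_cons, List.cons_append, chunks, if_neg (by omega), ← List.cons_append,
      List.take_append_of_le_length (by rw [hL]), List.take_of_length_le (by rw [hL]),
      List.drop_append_of_le_length (by rw [hL]), List.drop_of_length_le (by rw [hL]), List.nil_append,
      chunks_flatten ht Ls (fun L hL => hLs L (by simp [hL]))]

/-- `zipWith` over two `flatMap`s with blocks of a common length is the flattened `zipWith` of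
the blockwise `zipWith`s. [folklore] -/
theorem zipWith_flatMap {α β' γ : Type*} (h : β' → β' → γ) (φ ψ : α → List β') (t : ℕ)
    (hφ : ∀ a, (φ a).length = t) (hψ : ∀ a, (ψ a).length = t) :
    ∀ (Fb Gb : List α), Fb.length = Gb.length →
      List.zipWith h (Fb.flatMap φ) (Gb.flatMap ψ) = (List.zipWith (fun f g => List.zipWith h (φ f) (ψ g)) Fb Gb).flatten
  | [], [], _ => by simp
  | [], _ :: _, hl => by simp at hl
  | _ :: _, [], hl => by simp at hl
  | f :: Fb, g :: Gb, hl => by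
    rw [List.flatMap_cons, List.flatMap_cons, List.zipWith_append (by rw [hφ, hψ]), List.zipWith_cons_cons, List.flatten_cons,
      zipWith_flatMap h φ ψ t hφ hψ Fb Gb (by simpa using hl)]

variable (N : ℕ)

/-- One descent of the breadth-first multiplier on one side of the batch: digits, then the
forward transform, instance by instance (flat). [folklore] -/
def descOne (k : ℕ) (Fb : List (List ℕ)) : List (List ℕ) :=
  Fb.flatMap fun f => fwdN N (2 ^ ((k + 1) / 2)) (2 * 2 ^ ((k + 1) / 2)) (k / 2) (digits (2 ^ ((k + 1) / 2)) (2 ^ (k / 2)) f)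

/-- One ascent: the flat list of leaf products is cut into the instances' chunks of `2^{k/2}`
blocks, each inverse-transformed and overlap-added. [folklore] -/
def ascOne (k : ℕ) (P : List (List ℕ)) : List (List ℕ) :=
  (chunks (2 ^ (k / 2)) P).map fun C => overlapAdd N (2 ^ ((k + 1) / 2)) (invN N (2 ^ ((k + 1) / 2)) (2 * 2 ^ ((k + 1) / 2)) (k / 2) C)

/-- **The breadth-first recursion** the stack machine runs: descend on both sides, recurse on the
flat batches, ascend. [folklore] -/
def bfRec : ℕ → List (List ℕ) → List (List ℕ) → List (List ℕ)
  | k, Fb, Gb =>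
    if hk : k ≤ 3 then List.zipWith (negMul N (2 ^ k)) Fb Gb
    else ascOne N k (bfRec ((k + 1) / 2 + 1) (descOne N k Fb) (descOne N k Gb))
  termination_by k => k
  decreasing_by omega

variable {N}

/-- Each instance contributes `2^{k/2}` blocks to a descent. [folklore] -/
theorem length_fwdN_digits (k : ℕ) (f : List ℕ) :
    (fwdN N (2 ^ ((k + 1) / 2)) (2 * 2 ^ ((k + 1) / 2)) (k / 2) (digits (2 ^ ((k + 1) / 2)) (2 ^ (k / 2)) f)).length = 2 ^ (k / 2) :=
  length_fwdN _ _ (length_digits _ _)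

/-- Length of a descent. [folklore] -/
theorem length_descOne (k : ℕ) (Fb : List (List ℕ)) : (descOne N k Fb).length = Fb.length * 2 ^ (k / 2) := by
  unfold descOne
  rw [List.length_flatMap, List.map_congr_left (fun f _ => length_fwdN_digits k f), List.map_const', List.sum_replicate, smul_eq_mul]

/-- **Breadth-first = depth-first**: on batches of equal size the breadth-first recursion computes
`negMulRec` pair by pair. [folklore] -/
theorem bfRec_eq (k : ℕ) : ∀ (Fb Gb : List (List ℕ)), Fb.length = Gb.length → bfRec N k Fb Gb = List.zipWith (negMulRec N k) Fb Gb := by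
  induction k using Nat.strong_induction_on with
  | _ k ih =>
    intro Fb Gb hl
    rw [bfRec]
    split_ifs with hk
    · congr 1; funext f g; rw [negMulRec, dif_pos hk]
    · have hlt : (k + 1) / 2 + 1 < k := by omega
      rw [ih _ hlt _ _ (by rw [length_descOne, length_descOne, hl])]
      unfold descOne ascOne
      rw [zipWith_flatMap _ _ _ (2 ^ (k / 2)) (length_fwdN_digits k) (length_fwdN_digits k) Fb Gb hl,
        chunks_flatten (Nat.two_pow_pos _) _ (fun L hL => ?_), List.map_zipWith]
      · congr 1; funext f g; rw [negMulRec, dif_neg hk]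
      · obtain ⟨f, -, g, -, rfl⟩ := Com.exists_mem_of_mem_zipWith hL
        rw [List.length_zipWith, length_fwdN_digits, length_fwdN_digits, min_self]

/-- The twiddle lists of the levels: level `j` of `B` trees rooted at `F`. [folklore] -/
def twAt (m F B j : ℕ) : List ℕ := (childTw m)^[j] (List.replicate B F)

/-- `invBatch` over `B` equal roots is the chunkwise inverse transform. [folklore] -/
theorem invBatch_replicate {m : ℕ} (F r : ℕ) : ∀ (B : ℕ) (M : List (List ℕ)), M.length = B * 2 ^ r →
    invBatch N m r (List.replicate B F) M = ((chunks (2 ^ r) M).map fun C => invN N m F r C).flatten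
  | 0, M, hM => by
    rw [Nat.zero_mul, List.length_eq_zero_iff] at hM; subst hM; simp [invBatch, chunks]
  | B + 1, M, hM => by
    have h2 : 2 ^ r ≤ M.length := by rw [hM]; nlinarith [Nat.two_pow_pos r]
    obtain ⟨a, M', rfl⟩ : ∃ a M', M = a :: M' := by
      cases M with
      | nil => exfalso; have := Nat.two_pow_pos r; simp at h2
      | cons a M' => exact ⟨a, M', rfl⟩
    rw [List.replicate_succ, invBatch, chunks, if_neg (by have := Nat.two_pow_pos r; omega), List.map_cons, List.flatten_cons,
      invBatch_replicate F r B _ (by rw [List.length_drop, hM, Nat.succ_mul]; omega)]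

end NegFFT

end Literature.Computability.Complexity
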